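import Summits.MatrixMultiplication.OmegaCensus.STPPVosperSlackTwoCheckers
import Summits.MatrixMultiplication.OmegaCensus.STPPBlockVolumeFilter

/-!
# ω-census (abelian STPP census): soundness lemmas for the slack-2 partition checkers, II — admissibility, accumulated cover, translate masks (kernel tool)

HONEST FRAMING (pub-omega census; verbatim): lottery ticket; floor = certified bounds/negative ranges.
Census STRUCTURE (seat pub-omega-stpp-1 gen 32, 2026-08-28), family (b2).  Continuation of `STPPVosperSlackTwoCheckers.lean` §6–§9 (control-flow
exhaustiveness of `tilesAll`, `realisationsDead`, `caseADeadQ'`): the generic facts the law's soundness proof (HOME `pub-omega-stpp-1-g32/SLACK2-DESIGN.md`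
§SOUNDNESS PLAN item 4) needs to FEED those lemmas from an actual STPP family — `admissible_of_pairwise` (pairwise disjoint translates, each disjoint from the
initial cover, are sequentially admissible in any order), `tb_foldl_lor` (meaning of the accumulated cover), `tb_transMask` / `mem_transMasks` /
`map_fst_transMasks` (meaning and shape of the translate-mask list).  UNCONDITIONAL; no `decide`.  Nothing here is progress on `ω`.

References: H. Cohn, R. Kleinberg, B. Szegedy, C. Umans, FOCS 2005 (arXiv:math/0511460), Def. 5.1.
-/

namespace Summit.MatrixMultiplication.OmegaCensus.CubeNB.S2

open Summit.MatrixMultiplication.OmegaCensus.CubeNB.Bits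

/-! ## §10 Admissibility from pairwise disjointness, the accumulated cover, the translate masks -/

/-- A mask disjoint from `cov` and from `m` is disjoint from `cov ||| m`. [folklore] -/
theorem disjB_lor {n cov m : ℕ} (h1 : disjB n cov = true) (h2 : disjB n m = true) : disjB n (cov ||| m) = true := by
  rw [disjB_eq_true_iff] at h1 h2 ⊢
  intro i ⟨hn, hc⟩
  rw [tb_lor, Bool.or_eq_true] at hc
  rcases hc with hc | hc
  · exact h1 i ⟨hn, hc⟩
  · exact h2 i ⟨hn, hc⟩

/-- **Sequential admissibility from pairwise disjointness**: masks pairwise disjoint and each disjoint from `cov` form an admissible sequence from `cov`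
(in any order). [folklore] -/
theorem admissible_of_pairwise : ∀ (rs : List (ℕ × ℕ)) (cov : ℕ), (∀ x ∈ rs, disjB x.2 cov = true) →
    rs.Pairwise (fun x y => disjB y.2 x.2 = true) → admissible cov rs = true
  | [], _, _, _ => rfl
  | x :: rs, cov, h1, h2 => by
    rw [admissible, Bool.and_eq_true]
    rw [List.pairwise_cons] at h2
    refine ⟨h1 x (by simp), admissible_of_pairwise rs (cov ||| x.2) (fun y hy => disjB_lor (h1 y (by simp [hy])) (h2.1 y hy)) h2.2⟩

/-- **Meaning of the accumulated cover**: bit `i` of `rs.foldl (· ||| ·.2) cov` is set iff it is set in `cov` or in some chosen mask. [folklore] -/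
theorem tb_foldl_lor (i : ℕ) : ∀ (rs : List (ℕ × ℕ)) (cov : ℕ),
    tb (rs.foldl (fun cv x => cv ||| x.2) cov) i = true ↔ tb cov i = true ∨ ∃ x ∈ rs, tb x.2 i = true
  | [], cov => by simp
  | x :: rs, cov => by
    rw [List.foldl_cons, tb_foldl_lor i rs (cov ||| x.2), tb_lor, Bool.or_eq_true]
    constructor
    · rintro (⟨h | h⟩ | ⟨y, hy, h⟩)
      · exact Or.inl h
      · exact Or.inr ⟨x, by simp, h⟩
      · exact Or.inr ⟨y, by simp [hy], h⟩
    · rintro (h | ⟨y, hy, h⟩)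
      · exact Or.inl (Or.inl h)
      · rcases List.mem_cons.1 hy with rfl | hy
        · exact Or.inl (Or.inr h)
        · exact Or.inr ⟨y, hy, h⟩

/-- **Meaning of a translate mask**: bit `v` of the mask of `r − patt` is set iff `v = (r + p − y) mod p` for some `y ∈ patt`. [folklore] -/
theorem tb_transMask (p : ℕ) (patt : List ℕ) (r v : ℕ) :
    tb (maskOf (patt.map fun y => (r + p - y) % p)) v = true ↔ ∃ y ∈ patt, (r + p - y) % p = v := by
  rw [tb_maskOf, List.mem_map]

/-- The members of `transMasks`: position `r < p` paired with the mask of `r − patt`. [folklore] -/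
theorem mem_transMasks {p : ℕ} {patt : List ℕ} {x : ℕ × ℕ} :
    x ∈ transMasks p patt ↔ ∃ r < p, x = (r, maskOf (patt.map fun y => (r + p - y) % p)) := by
  rw [transMasks, List.mem_map]
  constructor
  · rintro ⟨r, hr, rfl⟩
    exact ⟨r, List.mem_range.1 hr, rfl⟩
  · rintro ⟨r, hr, rfl⟩
    exact ⟨r, List.mem_range.2 hr, rfl⟩

/-- `transMasks` has the positions `0, 1, …, p − 1` in order: its first components are `List.range p`. [folklore] -/
theorem map_fst_transMasks (p : ℕ) (patt : List ℕ) : (transMasks p patt).map Prod.fst = List.range p := by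
  rw [transMasks, List.map_map]
  exact List.map_id'' (fun _ => rfl) _


/-! ## §11 Meaning of the folded masks (candidate sets `Zc`, `Yc`, the sumset masks `tM`, `syM`) and of the interval masks -/

/-- Bits of a conjunction fold: set in the start mask and in every folded mask. [folklore] -/
theorem tb_foldl_land {α : Type*} (f : α → ℕ) (v : ℕ) : ∀ (l : List α) (init : ℕ),
    tb (l.foldl (fun m q => m &&& f q) init) v = true ↔ tb init v = true ∧ ∀ q ∈ l, tb (f q) v = true
  | [], init => by simp
  | q :: l, init => by
    rw [List.foldl_cons, tb_foldl_land f v l (init &&& f q), tb_land, Bool.and_eq_true]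
    constructor
    · rintro ⟨⟨h1, h2⟩, h3⟩
      exact ⟨h1, fun q' hq' => by
        rcases List.mem_cons.1 hq' with rfl | hq'
        · exact h2
        · exact h3 q' hq'⟩
    · rintro ⟨h1, h2⟩
      exact ⟨⟨h1, h2 q (by simp)⟩, fun q' hq' => h2 q' (by simp [hq'])⟩

/-- Bits of a disjunction fold from `0`: set in some folded mask. [folklore] -/
theorem tb_foldl_lor_fun {α : Type*} (f : α → ℕ) (v : ℕ) : ∀ (l : List α) (init : ℕ),
    tb (l.foldl (fun m q => m ||| f q) init) v = true ↔ tb init v = true ∨ ∃ q ∈ l, tb (f q) v = true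
  | [], init => by simp
  | q :: l, init => by
    rw [List.foldl_cons, tb_foldl_lor_fun f v l (init ||| f q), tb_lor, Bool.or_eq_true]
    constructor
    · rintro (⟨h | h⟩ | ⟨q', hq', h⟩)
      · exact Or.inl h
      · exact Or.inr ⟨q, by simp, h⟩
      · exact Or.inr ⟨q', by simp [hq'], h⟩
    · rintro (h | ⟨q', hq', h⟩)
      · exact Or.inl (Or.inl h)
      · rcases List.mem_cons.1 hq' with rfl | hq'
        · exact Or.inl (Or.inr h)
        · exact Or.inr ⟨q', hq', h⟩

/-- `tb 0 v = false`. [folklore] -/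
theorem tb_zero (v : ℕ) : tb 0 v = false := by
  rw [tb_eq_testBit, Nat.zero_testBit]

/-- **Meaning of the candidate mask** `⋂_{q ∈ Q} (M + q)` computed as `Q.foldl (· &&& rot p M ·) (fullMask p)`: for `M < 2^p`, all `q ∈ Q` below `p` and
`v < p`, bit `v` is set iff `v − q ∈ M` for every `q ∈ Q`. [folklore] -/
theorem tb_foldl_land_rot {p M v : ℕ} {Q : List ℕ} (hM : M < 2 ^ p) (hQ : ∀ q ∈ Q, q < p) (hv : v < p) :
    tb (Q.foldl (fun m q => m &&& rot p M q) (fullMask p)) v = true ↔ ∀ q ∈ Q, tb M ((v + p - q) % p) = true := by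
  rw [tb_foldl_land (fun q => rot p M q) v Q (fullMask p), tb_fullMask, decide_eq_true hv]
  constructor
  · rintro ⟨-, h⟩ q hq
    have h' := h q hq
    rwa [tb_rot hM (le_of_lt (hQ q hq)) hv] at h'
  · intro h
    exact ⟨rfl, fun q hq => by rw [tb_rot hM (le_of_lt (hQ q hq)) hv]; exact h q hq⟩

/-- **Meaning of the sumset mask** `⋃_{q ∈ Q} (M − q)` computed as `Q.foldl (· ||| rot p M (p − q)) 0`: for `M < 2^p`, `q ∈ Q` below `p`, `v < p`,
bit `v` is set iff `v + q ∈ M (mod p)` for some `q ∈ Q`. [folklore] -/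
theorem tb_foldl_lor_rot {p M v : ℕ} {Q : List ℕ} (hM : M < 2 ^ p) (hQ : ∀ q ∈ Q, q < p) (hv : v < p) :
    tb (Q.foldl (fun m q => m ||| rot p M (p - q)) 0) v = true ↔ ∃ q ∈ Q, tb M ((v + q) % p) = true := by
  rw [tb_foldl_lor_fun (fun q => rot p M (p - q)) v Q 0, tb_zero]
  constructor
  · rintro (h | ⟨q, hq, h⟩)
    · exact Bool.noConfusion h
    · refine ⟨q, hq, ?_⟩
      rw [tb_rot hM (Nat.sub_le p q) hv] at h
      have hq' := hQ q hq
      rwa [show v + p - (p - q) = v + q by omega] at h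
  · rintro ⟨q, hq, h⟩
    refine Or.inr ⟨q, hq, ?_⟩
    rw [tb_rot hM (Nat.sub_le p q) hv]
    have hq' := hQ q hq
    rwa [show v + p - (p - q) = v + q by omega]

/-- **Meaning of an interval mask**: bit `v` of the mask of `[s, s + len) mod p` is set iff `v = (s + t) mod p` for some `t < len`. [folklore] -/
theorem tb_ivlMask (p s len v : ℕ) : tb (maskOf ((List.range len).map fun t => (s + t) % p)) v = true ↔ ∃ t < len, (s + t) % p = v := by
  rw [tb_maskOf, List.mem_map]
  constructor
  · rintro ⟨t, ht, rfl⟩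
    exact ⟨t, List.mem_range.1 ht, rfl⟩
  · rintro ⟨t, ht, rfl⟩
    exact ⟨t, List.mem_range.2 ht, rfl⟩

/-- The members of `ivlMasks`. [folklore] -/
theorem mem_ivlMasks {p len : ℕ} {x : ℕ × ℕ} :
    x ∈ ivlMasks p len ↔ ∃ s < p, x = (s, maskOf ((List.range len).map fun t => (s + t) % p)) := by
  rw [ivlMasks, List.mem_map]
  constructor
  · rintro ⟨s, hs, rfl⟩
    exact ⟨s, List.mem_range.1 hs, rfl⟩
  · rintro ⟨s, hs, rfl⟩
    exact ⟨s, List.mem_range.2 hs, rfl⟩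

/-! ## §12 From an actual tiling to an admissible choice sequence of the loop -/

/-- `(range p).drop 1 = range' 1 (p − 1)`. [folklore] -/
theorem drop_one_range (p : ℕ) : (List.range p).drop 1 = List.range' 1 (p - 1) := by
  cases p with
  | zero => rfl
  | succ n =>
    rw [List.range_succ_eq_map, Nat.add_sub_cancel, List.range'_eq_map_range]
    simp only [List.drop_succ_cons, List.drop_zero]
    exact List.map_congr_left fun x _ => Nat.add_comm x 1

/-- **The admissible choice sequence of an actual tiling.**  Let `RS` be a set of positions in `[1, p)` such that the translates `r − patt`, `r ∈ RS`, are
pairwise disjoint and each is disjoint from the cover `cov₀`.  Then the sub-sequence of `(transMasks p patt).drop 1` with positions in `RS` is a sublist of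
it, has `#RS` members, is sequentially admissible from `cov₀`, and lists exactly the positions of `RS`. [folklore] -/
theorem admissible_filter_transMasks (p : ℕ) (patt : List ℕ) (cov₀ : ℕ) (RS : Finset ℕ) (hRS : ∀ r ∈ RS, 1 ≤ r ∧ r < p)
    (hcov : ∀ r ∈ RS, ∀ y ∈ patt, tb cov₀ ((r + p - y) % p) = false)
    (hpair : ∀ r ∈ RS, ∀ r' ∈ RS, r ≠ r' → ∀ y ∈ patt, ∀ y' ∈ patt, (r + p - y) % p ≠ (r' + p - y') % p) :
    (((transMasks p patt).drop 1).filter fun x => decide (x.1 ∈ RS)).Sublist ((transMasks p patt).drop 1) ∧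
    (((transMasks p patt).drop 1).filter fun x => decide (x.1 ∈ RS)).length = RS.card ∧
    admissible cov₀ (((transMasks p patt).drop 1).filter fun x => decide (x.1 ∈ RS)) = true ∧
    (∀ x, x ∈ (((transMasks p patt).drop 1).filter fun x => decide (x.1 ∈ RS)) ↔
      x.1 ∈ RS ∧ x = (x.1, maskOf (patt.map fun y => (x.1 + p - y) % p))) := by
  set rs := ((transMasks p patt).drop 1).filter fun x => decide (x.1 ∈ RS) with hrs
  -- membership
  have hdrop : ∀ x, x ∈ (transMasks p patt).drop 1 ↔ ∃ r, 1 ≤ r ∧ r < p ∧ x = (r, maskOf (patt.map fun y => (r + p - y) % p)) := by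
    intro x
    rw [transMasks, ← List.map_drop, drop_one_range, List.mem_map]
    constructor
    · rintro ⟨r, hr, rfl⟩
      rw [List.mem_range'_1] at hr
      exact ⟨r, hr.1, by omega, rfl⟩
    · rintro ⟨r, h1, h2, rfl⟩
      exact ⟨r, List.mem_range'_1.2 ⟨h1, by omega⟩, rfl⟩
  have hmem : ∀ x, x ∈ rs ↔ x.1 ∈ RS ∧ x = (x.1, maskOf (patt.map fun y => (x.1 + p - y) % p)) := by
    intro x
    rw [hrs, List.mem_filter, decide_eq_true_eq, hdrop]
    constructor
    · rintro ⟨⟨r, _, _, rfl⟩, hx⟩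
      exact ⟨hx, rfl⟩
    · rintro ⟨hx, hxe⟩
      obtain ⟨h1, h2⟩ := hRS _ hx
      exact ⟨⟨x.1, h1, h2, hxe⟩, hx⟩
  -- positions: map fst rs = (range' 1 (p-1)).filter (∈ RS), duplicate-free
  have hfst : rs.map Prod.fst = (List.range' 1 (p - 1)).filter fun r => decide (r ∈ RS) := by
    rw [hrs, transMasks, ← List.map_drop, drop_one_range, List.filter_map, List.map_map]
    have : (Prod.fst ∘ fun r => (r, maskOf (patt.map fun y => (r + p - y) % p))) = id := rfl
    rw [this, List.map_id]
    rfl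
  have hnd1 : (List.range' 1 (p - 1)).Nodup := by
    rw [← drop_one_range]; exact (List.nodup_range).sublist (List.drop_sublist _ _)
  have hnd : (rs.map Prod.fst).Nodup := by
    rw [hfst]; exact hnd1.filter _
  refine ⟨List.filter_sublist, ?_, ?_, hmem⟩
  · -- length
    rw [← List.length_map (f := Prod.fst), hfst]
    have hset : ((List.range' 1 (p - 1)).filter fun r => decide (r ∈ RS)).toFinset = RS := by
      ext r
      rw [List.mem_toFinset, List.mem_filter, decide_eq_true_eq, List.mem_range'_1]
      constructor
      · exact fun h => h.2
      · intro h
        obtain ⟨h1, h2⟩ := hRS r h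
        exact ⟨⟨h1, by omega⟩, h⟩
    have hl := List.toFinset_card_of_nodup (hnd1.filter fun r => decide (r ∈ RS))
    rw [hset] at hl
    exact hl.symm
  · -- admissibility
    refine admissible_of_pairwise rs cov₀ (fun x hx => ?_) ?_
    · obtain ⟨hx1, hxe⟩ := (hmem x).1 hx
      rw [hxe]
      rw [disjB_eq_true_iff]
      rintro v ⟨hv1, hv2⟩
      obtain ⟨y, hy, rfl⟩ := (tb_transMask p patt x.1 v).1 hv1
      rw [hcov x.1 hx1 y hy] at hv2
      exact Bool.noConfusion hv2
    · have hpw : rs.Pairwise fun x y => x.1 ≠ y.1 := List.pairwise_map.1 hnd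
      refine hpw.imp_of_mem ?_
      intro x x' hx hx' hne
      obtain ⟨hx1, hxe⟩ := (hmem x).1 hx
      obtain ⟨hx1', hxe'⟩ := (hmem x').1 hx'
      rw [hxe, hxe', disjB_eq_true_iff]
      rintro v ⟨hv1, hv2⟩
      obtain ⟨y', hy', rfl⟩ := (tb_transMask p patt x'.1 v).1 hv1
      obtain ⟨y, hy, hyy⟩ := (tb_transMask p patt x.1 _).1 hv2
      exact hpair x.1 hx1 x'.1 hx1' hne y hy y' hy' hyy

/-! ## §13 Enumeration completeness of the free shapes -/

/-- A strictly increasing list of naturals inside `[s, s + n)` is a sublist of `range' s n`. [folklore] -/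
theorem sublist_range'_of_pairwise_lt : ∀ (n s : ℕ) (q : List ℕ), q.Pairwise (· < ·) → (∀ x ∈ q, s ≤ x ∧ x < s + n) →
    q.Sublist (List.range' s n)
  | 0, s, q, _, hb => by
    rcases q with _ | ⟨x, q⟩
    · exact List.Sublist.slnil
    · exact absurd (hb x (by simp)) (by omega)
  | n + 1, s, q, hq, hb => by
    rw [List.range'_succ]
    rcases q with _ | ⟨x, q⟩
    · exact List.nil_sublist _
    · rw [List.pairwise_cons] at hq
      by_cases hx : x = s
      · subst hx
        exact List.Sublist.cons_cons x (sublist_range'_of_pairwise_lt n (x + 1) q hq.2 fun y hy =>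
          ⟨hq.1 y hy, by have := (hb y (by simp [hy])).2; omega⟩)
      · have hxs : s < x := by have := (hb x (by simp)).1; omega
        exact List.Sublist.cons s (sublist_range'_of_pairwise_lt n (s + 1) (x :: q) (List.pairwise_cons.2 hq) fun y hy => by
          rcases List.mem_cons.1 hy with rfl | hy
          · exact ⟨hxs, by have := (hb y (by simp)).2; omega⟩
          · exact ⟨by have := hq.1 y hy; omega, by have := (hb y (by simp [hy])).2; omega⟩)

/-- **Every free shape is enumerated**: a strictly increasing list of `b ≥ 1` residues `< p` containing `0` is a member of
`qShapes p b 0 ((p − 1).choose (b − 1))` (the whole enumeration). [folklore] -/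
theorem mem_qShapes_of_pairwise_lt {p b : ℕ} (Q : List ℕ) (hQ : Q.Pairwise (· < ·)) (hlt : ∀ q ∈ Q, q < p) (h0 : 0 ∈ Q)
    (hlen : Q.length = b) : Q ∈ qShapes p b 0 ((p - 1).choose (b - 1)) := by
  rcases Q with _ | ⟨x, q⟩
  · simp at h0
  · rw [List.pairwise_cons] at hQ
    have hx : x = 0 := by
      rcases List.mem_cons.1 h0 with h | h
      · exact h.symm
      · have := hQ.1 0 h; omega
    subst hx
    rw [qShapes, List.drop_zero, Nat.sub_zero]
    have hfull : (((List.range' 1 (p - 1)).sublistsLen (b - 1)).map fun q => 0 :: q).length = (p - 1).choose (b - 1) := by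
      rw [List.length_map, List.length_sublistsLen, List.length_range']
    rw [← hfull, List.take_length, List.mem_map]
    refine ⟨q, List.mem_sublistsLen.2 ⟨sublist_range'_of_pairwise_lt (p - 1) 1 q hQ.2 fun y hy => ⟨?_, ?_⟩, ?_⟩, rfl⟩
    · have := hQ.1 y hy; omega
    · have := hlt y (by simp [hy]); omega
    · rw [List.length_cons] at hlen; omega

/-! ## §14 Value lists and the same-block injectivities of an STPP family (inputs of the normal-form lemma) -/

section Packing

open Finset
open Literature.Computability.AlgebraicComplexity
open Summit.MatrixMultiplication.OmegaCensus.STPPKneser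

variable {p : ℕ} [hp : Fact p.Prime]

/-- **Value list of a finite set of `ℤ/p`** (increasing): membership, duplicate-freeness, range, length. [folklore] -/
theorem valList_spec (S : Finset (ZMod p)) :
    (∀ q, q ∈ ((S.image ZMod.val).sort (· ≤ ·)) ↔ ∃ b ∈ S, b.val = q) ∧ ((S.image ZMod.val).sort (· ≤ ·)).Nodup ∧
      (∀ q ∈ ((S.image ZMod.val).sort (· ≤ ·)), q < p) ∧ ((S.image ZMod.val).sort (· ≤ ·)).length = #S := by
  refine ⟨fun q => ?_, Finset.sort_nodup _ _, fun q hq => ?_, ?_⟩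
  · rw [Finset.mem_sort, Finset.mem_image]
  · rw [Finset.mem_sort, Finset.mem_image] at hq
    obtain ⟨b, _, rfl⟩ := hq
    exact b.val_lt
  · rw [Finset.length_sort, Finset.card_image_of_injective _ (ZMod.val_injective p)]

/-- Same-block injectivity `(a, b) ↦ a + b` on `Aᵢ × Bᵢ` (Def 5.1 with `i = j = k`). [cite: CohnKleinbergSzegedyUmans2005, Def. 5.1] -/
theorem add_injOn_AB {N : ℕ} {A B C : Fin N → Finset (ZMod p)} (hS : IsSTPP A B C) (hC : ∀ i, (C i).Nonempty) (i : Fin N)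
    {a a' b b' : ZMod p} (ha : a ∈ A i) (ha' : a' ∈ A i) (hb : b ∈ B i) (hb' : b' ∈ B i) (h : a + b = a' + b') : a = a' ∧ b = b' := by
  obtain ⟨u, hu⟩ := hC i
  have hrel : (a' - a) + (b' - b) + (u - u) = 0 := by
    have h' := sub_eq_zero.2 h; rw [sub_self, add_zero, ← neg_eq_zero, ← h']; abel
  obtain ⟨-, -, h1, h2, -⟩ := hS i i i a ha a' ha' b hb b' hb' u hu u hu hrel
  exact ⟨h1, h2⟩

/-- Same-block injectivity `(b, c) ↦ c − b` on `Bᵢ × Cᵢ`. [cite: CohnKleinbergSzegedyUmans2005, Def. 5.1] -/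
theorem sub_injOn_CB {N : ℕ} {A B C : Fin N → Finset (ZMod p)} (hS : IsSTPP A B C) (hA : ∀ i, (A i).Nonempty) (i : Fin N)
    {b b' c c' : ZMod p} (hb : b ∈ B i) (hb' : b' ∈ B i) (hc : c ∈ C i) (hc' : c' ∈ C i) (h : c - b = c' - b') : b = b' ∧ c = c' := by
  obtain ⟨s, hs⟩ := hA i
  have hrel : (s - s) + (b' - b) + (c - c') = 0 := by
    have h' := sub_eq_zero.2 h; rw [sub_self, zero_add, ← h']; abel
  obtain ⟨-, -, -, h1, h2⟩ := hS i i i s hs s hs b hb b' hb' c' hc' c hc hrel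
  exact ⟨h1, h2.symm⟩

/-- Same-block injectivity `(a, c) ↦ c − a` on `Aᵢ × Cᵢ`. [cite: CohnKleinbergSzegedyUmans2005, Def. 5.1] -/
theorem sub_injOn_CA {N : ℕ} {A B C : Fin N → Finset (ZMod p)} (hS : IsSTPP A B C) (hB : ∀ i, (B i).Nonempty) (i : Fin N)
    {a a' c c' : ZMod p} (ha : a ∈ A i) (ha' : a' ∈ A i) (hc : c ∈ C i) (hc' : c' ∈ C i) (h : c - a = c' - a') : a = a' ∧ c = c' := by
  obtain ⟨t, ht⟩ := hB i
  have hrel : (a - a') + (t - t) + (c' - c) = 0 := by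
    have h' := sub_eq_zero.2 h; rw [sub_self, add_zero, ← neg_eq_zero, ← h']; abel
  obtain ⟨-, -, h1, -, h2⟩ := hS i i i a' ha' a ha t ht t ht c hc c' hc' hrel
  exact ⟨h1.symm, h2⟩

/-- Same-block injectivity `(a, b) ↦ a − b` on `Aᵢ × Bᵢ`. [cite: CohnKleinbergSzegedyUmans2005, Def. 5.1] -/
theorem sub_injOn_AB {N : ℕ} {A B C : Fin N → Finset (ZMod p)} (hS : IsSTPP A B C) (hC : ∀ i, (C i).Nonempty) (i : Fin N)
    {a a' b b' : ZMod p} (ha : a ∈ A i) (ha' : a' ∈ A i) (hb : b ∈ B i) (hb' : b' ∈ B i) (h : a - b = a' - b') : a = a' ∧ b = b' := by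
  obtain ⟨u, hu⟩ := hC i
  have hrel : (a - a') + (b' - b) + (u - u) = 0 := by
    have h' := sub_eq_zero.2 h; rw [sub_self, add_zero, ← h']; abel
  obtain ⟨-, -, h1, h2, -⟩ := hS i i i a' ha' a ha b hb b' hb' u hu u hu hrel
  exact ⟨h1.symm, h2⟩

/-- Block-sum injectivity `(a, b, c) ↦ c − a − b` on `Aᵢ × Bᵢ × Cᵢ` (from `card_image_blockSum`). [cite: CohnKleinbergSzegedyUmans2005, Def. 5.1] -/
theorem blockSum_inj {N : ℕ} {A B C : Fin N → Finset (ZMod p)} (hS : IsSTPP A B C) (i : Fin N)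
    {a a' b b' c c' : ZMod p} (ha : a ∈ A i) (ha' : a' ∈ A i) (hb : b ∈ B i) (hb' : b' ∈ B i) (hc : c ∈ C i) (hc' : c' ∈ C i)
    (h : c - a - b = c' - a' - b') : a = a' ∧ b = b' ∧ c = c' := by
  have hcard := card_image_blockSum hS i 0
  rw [mul_assoc, ← Finset.card_product, ← Finset.card_product] at hcard
  have hinj := Finset.card_image_iff.1 hcard
  have hm : (a, b, c) ∈ ((A i ×ˢ (B i ×ˢ C i) : Finset _) : Set (ZMod p × ZMod p × ZMod p)) :=
    Finset.mem_coe.2 (Finset.mem_product.2 ⟨ha, Finset.mem_product.2 ⟨hb, hc⟩⟩)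
  have hm' : (a', b', c') ∈ ((A i ×ˢ (B i ×ˢ C i) : Finset _) : Set (ZMod p × ZMod p × ZMod p)) :=
    Finset.mem_coe.2 (Finset.mem_product.2 ⟨ha', Finset.mem_product.2 ⟨hb', hc'⟩⟩)
  have heq : (fun q : ZMod p × ZMod p × ZMod p => (0 : ZMod p) + q.2.2 - q.1 - q.2.1) (a, b, c) =
      (fun q : ZMod p × ZMod p × ZMod p => (0 : ZMod p) + q.2.2 - q.1 - q.2.1) (a', b', c') := by
    show (0 : ZMod p) + c - a - b = 0 + c' - a' - b'
    rw [zero_add, zero_add, h]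
  have := hinj hm hm' heq
  simp only [Prod.mk.injEq] at this
  exact ⟨this.1, this.2.1, this.2.2⟩

end Packing

end Summit.MatrixMultiplication.OmegaCensus.CubeNB.S2
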